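import Literature.NumberTheory.GaloisRepresentations.IdeleHerbrandQuotient
import HarnessLib

/-!
# The Herbrand quotient of the unit ideles of a cyclic extension (Childress Prop. 5.7)

Topic `NumberTheory/GaloisRepresentations` (class field theory: Childress, *Class Field Theory*,
Ch. 4 §5 Prop. 5.7 (iii) and the computation "`Q_G(𝓔_K) = 2^a`", PDF pp. 98–99, towards the
global cyclic norm index inequality Thm. 5.12); namespace
`Literature.NumberTheory.GaloisRepresentations.IdeleHerbrand` (continuing
`IdeleHerbrandQuotient.lean`).  Definitions with their API; everything **proved**; the one
arithmetic input not yet in the tree — the triviality of `Ĥ⁰` and `Ĥ⁻¹` of the local units at the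
(unramified) places outside a finite set `S` (Childress Prop. 5.7 (iii), via Lemma 5.3) — enters
the final statements as an explicit hypothesis `hun`, spelled out inline (no named fact).

## Contents

* `Herbrand.h0_finsetSup_eq_prod`, `Herbrand.h1_finsetSup_eq_prod` — `Ĥⁱ` of a finite direct
  product of stable subgroups is the product (Childress, Exercise 4.21), by induction from
  `Herbrand.h0_sup_bot_eq_mul`.
* **Archimedean part** (`ArchimedeanHerbrand.lean` assembled over the infinite places of `F`):
  `ArchHerbrand.h1_top_eq_one` and `ArchHerbrand.h0_top_eq_archFactor`:
  `#Ĥ⁻¹(G, E_∞ˣ) = 1`, `#Ĥ⁰(G, E_∞ˣ) = archFactor F E = ∏_{v ∣ ∞} #G_{w_v} = 2^a`, `a` the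
  number of real places of `F` ramified in `E` (Childress: "`Q_G(𝓔_K) = 2^a`").
* **Unit ideles**: for a finite set `S` of finite places of `F`, `unitIdelesOn F E S` (units
  supported above `S` and at infinity) and `unitIdelesOff F E S` (units trivial above `S` and at
  infinity) decompose `unitIdeles E` as a direct product of `G`-stable subgroups;
  `unitIdelesOn = infIdeles · ∏_{v ∈ S} localUnitIdeles v` (independent), so its `Ĥⁱ` is
  `archFactor · ∏_{v ∈ S} hⁱ_v` resp. `∏ hⁱ_v` with `h⁰_v = h¹_v ≠ 0` (Prop. 5.7 (i));
  under the hypothesis `hun` (for `v ∉ S`, every `G`-fixed element of `∏_{w∣v} 𝒪_wˣ` is a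
  norm from it, resp. every norm-one element is `σy/y` — Childress Prop. 5.7 (iii), true for `S`
  containing the ramified places by Lemma 5.3) the group `unitIdelesOff S` has `Ĥ⁰ = Ĥ⁻¹ = 1`
  (the local solutions are assembled into an idele, `ofBlocks`);
  hence **`h0_unitIdeles_eq`, `h1_unitIdeles_eq`**: `#Ĥ⁰(G, 𝓔_E) = archFactor · X`,
  `#Ĥ⁻¹(G, 𝓔_E) = X` with `X = ∏_{v ∈ S} h⁰_v ≠ 0` — i.e. `Q_G(𝓔_E) = 2^a`.

## References

* N. Childress, *Class Field Theory*, Universitext, Springer 2009, Ch. 4 §5 Prop. 5.7 and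
  Exercise 4.21 (PDF pp. 92, 98–99). [Childress2009]
-/

noncomputable section

open NumberField IsDedekindDomain
open scoped Valued

namespace Literature.NumberTheory.GaloisRepresentations

/-! ### `Ĥⁱ` of finite direct products (Childress, Exercise 4.21) -/

namespace Herbrand

variable {G : Type*} {M : Type*} [Group G] [CommGroup M] [MulDistribMulAction G M]

/-- A finite supremum of stable subgroups is stable. [folklore] -/
theorem isStable_finsetSup {ι : Type*} (s : Finset ι) (A : ι → Subgroup M)
    (hA : ∀ i, IsStable G (A i)) : IsStable G (s.sup A) := by
  classical
  induction s using Finset.induction_on with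
  | empty => rw [Finset.sup_empty]; exact IsStable.bot
  | insert i t hi ih => rw [Finset.sup_insert]; exact (hA i).sup ih

variable [Fintype G] {σ : G}

/-- `h0` of the trivial subgroup is `1`. [folklore] -/
theorem h0_bot_bot : h0 σ (⊥ : Subgroup M) ⊥ = 1 := by
  rw [h0_def, Subgroup.relIndex_eq_one]
  exact fun x hx => le_b0 ((mem_z0.mp hx).1)

/-- `h1` of the trivial subgroup is `1`. [folklore] -/
theorem h1_bot_bot : h1 σ (⊥ : Subgroup M) ⊥ = 1 := by
  rw [h1_def, Subgroup.relIndex_eq_one]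
  exact fun x hx => le_b1 ((mem_z1.mp hx).1)

/-- **`Ĥ⁰` of a finite direct product of stable subgroups is the product of the `Ĥ⁰`**
(independence in the form: `A_i` meets the product of any other factors trivially).
[cite: Childress2009, Ch. 4 §5 Exercise 4.21 (PDF p. 92)] -/
theorem h0_finsetSup_eq_prod {ι : Type*} (s : Finset ι) (A : ι → Subgroup M)
    (hA : ∀ i, IsStable G (A i)) (hind : ∀ (t : Finset ι) (i : ι), i ∉ t → t.sup A ⊓ A i = ⊥) :
    h0 σ (s.sup A) ⊥ = ∏ i ∈ s, h0 σ (A i) ⊥ := by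
  classical
  induction s using Finset.induction_on with
  | empty => rw [Finset.sup_empty, Finset.prod_empty, h0_bot_bot]
  | insert i t hi ih =>
    rw [Finset.sup_insert, Finset.prod_insert hi, ← ih]
    refine h0_sup_bot_eq_mul (hA i) (isStable_finsetSup t A hA) ?_
    rw [inf_comm]; exact hind t i hi

/-- **`Ĥ⁻¹` of a finite direct product of stable subgroups is the product of the `Ĥ⁻¹`.**
[cite: Childress2009, Ch. 4 §5 Exercise 4.21 (PDF p. 92)] -/
theorem h1_finsetSup_eq_prod {ι : Type*} (s : Finset ι) (A : ι → Subgroup M)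
    (hA : ∀ i, IsStable G (A i)) (hind : ∀ (t : Finset ι) (i : ι), i ∉ t → t.sup A ⊓ A i = ⊥) :
    h1 σ (s.sup A) ⊥ = ∏ i ∈ s, h1 σ (A i) ⊥ := by
  classical
  induction s using Finset.induction_on with
  | empty => rw [Finset.sup_empty, Finset.prod_empty, h1_bot_bot]
  | insert i t hi ih =>
    rw [Finset.sup_insert, Finset.prod_insert hi, ← ih]
    refine h1_sup_bot_eq_mul (hA i) (isStable_finsetSup t A hA) ?_
    rw [inf_comm]; exact hind t i hi

end Herbrand

/-! ### The archimedean ideles over all infinite places of `F` -/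

namespace ArchHerbrand

open NumberField.InfinitePlace

variable {F : Type*} [Field F] {E : Type*} [Field E] [Algebra F E]

variable (E) in
/-- A chosen place of `E` above the infinite place `v` of `F` (they exist, `comap_surjective`).
[folklore] -/
def placeOver [Algebra.IsAlgebraic F E] (v : InfinitePlace F) : InfinitePlace E :=
  Classical.choose (comap_surjective (K := E) (k := F) v)

/-- `placeOver v ∣ v`. [folklore] -/
theorem isOver_placeOver [Algebra.IsAlgebraic F E] (v : InfinitePlace F) : IsOver E v (placeOver E v) :=
  Classical.choose_spec (comap_surjective (K := E) (k := F) v)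

variable (F E) in
/-- **The archimedean factor `2^a = ∏_{v ∣ ∞} #G_{w_v}`** (`#G_{w_v} = [E_{w_v} : F_v] ∈ {1, 2}`;
`a` = number of real places of `F` with a complex place of `E` above).
[cite: Childress2009, Ch. 4 §5 Prop. 5.10 (PDF p. 101)] -/
def archFactor [NumberField F] [Algebra.IsAlgebraic F E] : ℕ :=
  ∏ v : InfinitePlace F, Nat.card (MulAction.stabilizer (E ≃ₐ[F] E) (placeOver E v))

/-- Elements of a finite product of the `infUnits v` are trivial off the corresponding places.
[folklore] -/
theorem apply_eq_one_of_mem_finsetSup {t : Finset (InfinitePlace F)} {x : (InfiniteAdeleRing E)ˣ}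
    (hx : x ∈ t.sup (infUnits E)) (w : InfinitePlace E) (hw : ∀ v ∈ t, ¬ IsOver E v w) :
    (x : InfiniteAdeleRing E) w = 1 := by
  let K : Subgroup (InfiniteAdeleRing E)ˣ :=
    { carrier := {x | (x : InfiniteAdeleRing E) w = 1}
      one_mem' := rfl
      mul_mem' := fun {a b} ha hb => by
        show ((a * b : (InfiniteAdeleRing E)ˣ) : InfiniteAdeleRing E) w = 1
        rw [Units.val_mul, mul_apply', ha, hb, mul_one]
      inv_mem' := fun {a} ha => by
        show ((a⁻¹ : (InfiniteAdeleRing E)ˣ) : InfiniteAdeleRing E) w = 1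
        rw [inv_apply, ha, inv_one] }
  have hle : t.sup (infUnits E) ≤ K := Finset.sup_le fun v hv y hy => hy w (hw v hv)
  exact hle hx

/-- The `infUnits v` are independent. [folklore] -/
theorem finsetSup_infUnits_inf_eq_bot (t : Finset (InfinitePlace F)) (v : InfinitePlace F) (hv : v ∉ t) :
    t.sup (infUnits E) ⊓ infUnits E v = ⊥ := by
  rw [eq_bot_iff]
  rintro x ⟨hxt, hxv⟩
  rw [Subgroup.mem_bot]
  apply Units.ext; funext w
  rw [Units.val_one, one_apply']
  by_cases hw : IsOver E v w
  · refine apply_eq_one_of_mem_finsetSup hxt w fun v' hv' h' => hv ?_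
    have : v' = v := h'.symm.trans hw
    rwa [this] at hv'
  · exact hxv w hw

/-- Every archimedean idele is the product of its parts above the infinite places of `F`:
`⊤ = ∏_v infUnits v`. [folklore] -/
theorem finsetSup_infUnits_eq_top [NumberField F] :
    (Finset.univ : Finset (InfinitePlace F)).sup (infUnits E) = ⊤ := by
  classical
  rw [eq_top_iff]
  intro x _
  -- the part of `x` above `v`
  have hpart : ∀ v : InfinitePlace F, ∃ y ∈ infUnits E v, ∀ w,
      (y : InfiniteAdeleRing E) w = if IsOver E v w then (x : InfiniteAdeleRing E) w else 1 := by
    intro v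
    have hu : IsUnit (fun w => if IsOver E v w then (x : InfiniteAdeleRing E) w else 1 : InfiniteAdeleRing E) :=
      isUnit_of_forall_ne_zero fun w => by
        by_cases h : IsOver E v w
        · simp only [h, ↓reduceIte]; exact apply_ne_zero x w
        · simp only [h, ↓reduceIte]; exact one_ne_zero
    refine ⟨hu.unit, fun w hw => ?_, fun w => ?_⟩
    · rw [IsUnit.unit_spec]; simp only [hw, ↓reduceIte]
    · rw [IsUnit.unit_spec]
  choose y hy hyw using hpart
  have hx : x = ∏ v, y v := by
    apply Units.ext; funext w
    rw [Units.coe_prod, prod_apply', Finset.prod_eq_single (w.comap (algebraMap F E))]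
    · rw [hyw, if_pos (show IsOver E _ w from rfl)]
    · intro v _ hv
      rw [hyw, if_neg (fun h : IsOver E v w => hv h.symm)]
    · intro h; exact absurd (Finset.mem_univ _) h
  rw [hx]
  exact Subgroup.prod_mem _ fun v _ => Finset.le_sup (f := infUnits E) (Finset.mem_univ v) (hy v)

variable [NumberField F] [FiniteDimensional F E] [IsGalois F E]

/-- **`#Ĥ⁻¹(G, E_∞ˣ) = 1`** for `Gal(E/F) = ⟨σ⟩` cyclic. [cite: Childress2009, Ch. 4 §5 Prop. 5.7 (PDF pp. 98–99)] -/
theorem h1_top_eq_one {σ : E ≃ₐ[F] E} (hσ : ∀ τ : E ≃ₐ[F] E, τ ∈ Subgroup.zpowers σ) :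
    Herbrand.h1 σ (⊤ : Subgroup (InfiniteAdeleRing E)ˣ) ⊥ = 1 := by
  rw [← finsetSup_infUnits_eq_top (F := F), Herbrand.h1_finsetSup_eq_prod _ _ (fun v => isStable_infUnits v)
    (fun t v hv => finsetSup_infUnits_inf_eq_bot t v hv)]
  exact Finset.prod_eq_one fun v _ => h1_infUnits_eq_one hσ (isOver_placeOver v)

/-- **`#Ĥ⁰(G, E_∞ˣ) = 2^a = archFactor F E`** for `Gal(E/F) = ⟨σ⟩` cyclic (Childress:
`Q_G(𝓔_K) = 2^a`). [cite: Childress2009, Ch. 4 §5 Prop. 5.7 (PDF pp. 98–99)] -/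
theorem h0_top_eq_archFactor {σ : E ≃ₐ[F] E} (hσ : ∀ τ : E ≃ₐ[F] E, τ ∈ Subgroup.zpowers σ) :
    Herbrand.h0 σ (⊤ : Subgroup (InfiniteAdeleRing E)ˣ) ⊥ = archFactor F E := by
  rw [← finsetSup_infUnits_eq_top (F := F), Herbrand.h0_finsetSup_eq_prod _ _ (fun v => isStable_infUnits v)
    (fun t v hv => finsetSup_infUnits_inf_eq_bot t v hv)]
  exact Finset.prod_congr rfl fun v _ => h0_infUnits_eq_card_stabilizer hσ (isOver_placeOver v)

/-- `archFactor ≠ 0`. [folklore] -/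
theorem archFactor_ne_zero : archFactor F E ≠ 0 :=
  Finset.prod_ne_zero_iff.mpr fun _ _ => Nat.card_pos.ne'

end ArchHerbrand

/-! ### Unit ideles: support decompositions -/

namespace IdeleHerbrand

open Literature.NumberTheory.Automorphic

universe u

variable {F : Type u} [Field F] [NumberField F] {E : Type u} [Field E] [NumberField E] [Algebra F E]

/-- Finite components of a finite product of ideles. [folklore] -/
theorem snd_prod_apply {ι : Type*} (s : Finset ι) (f : ι → ideleGroup E) (w : HeightOneSpectrum (𝓞 E)) :
    ((∏ i ∈ s, f i : ideleGroup E) : AdeleRing (𝓞 E) E).2 w =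
      ∏ i ∈ s, ((f i : ideleGroup E) : AdeleRing (𝓞 E) E).2 w := by
  classical
  induction s using Finset.induction_on with
  | empty => rfl
  | insert a s ha ih => rw [Finset.prod_insert ha, Finset.prod_insert ha, snd_mul_apply, ih]

/-- Infinite part of a finite product of ideles. [folklore] -/
theorem fst_prod {ι : Type*} (s : Finset ι) (f : ι → ideleGroup E) :
    ((∏ i ∈ s, f i : ideleGroup E) : AdeleRing (𝓞 E) E).1 =
      ∏ i ∈ s, ((f i : ideleGroup E) : AdeleRing (𝓞 E) E).1 := by
  classical
  induction s using Finset.induction_on with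
  | empty => rfl
  | insert a s ha ih => rw [Finset.prod_insert ha, Finset.prod_insert ha, ideleGroup_val_fst_mul, ih]

/-- Infinite part of the inverse of an idele with trivial infinite part. [folklore] -/
theorem fst_inv_eq_one {x : ideleGroup E} (hx : (x : AdeleRing (𝓞 E) E).1 = 1) :
    ((x⁻¹ : ideleGroup E) : AdeleRing (𝓞 E) E).1 = 1 := by
  have := ideleGroup_val_inv_fst_mul x
  rwa [hx, mul_one] at this

omit [NumberField F] in
/-- `unitIdeles E` is `Gal(E/F)`-stable. [cite: CasselsFrohlichANT1967, Ch. VII §1.1] -/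
theorem isStable_unitIdeles : Herbrand.IsStable (E ≃ₐ[F] E) (unitIdeles E) := by
  intro σ x hx w
  rw [snd_smul_apply, valued_galAdicCompletionMap]; exact hx _

section Piece

open scoped Classical

/-- The idele with infinite part `a`, finite components those of the unit idele `x` where `P`
holds and `1` elsewhere. [folklore] -/
def piece (a : (InfiniteAdeleRing E)ˣ) (x : ideleGroup E) (hx : x ∈ unitIdeles E)
    (P : HeightOneSpectrum (𝓞 E) → Prop) : ideleGroup E where
  val := ((a : InfiniteAdeleRing E), RestrictedProduct.mk
    (fun w => if P w then (x : AdeleRing (𝓞 E) E).2 w else 1)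
    (Filter.Eventually.of_forall fun w => by
      by_cases h : P w
      · simp only [h, ↓reduceIte]
        exact (HeightOneSpectrum.mem_adicCompletionIntegers _ _ _).mpr (hx w).le
      · simp only [h, ↓reduceIte]; exact one_mem _))
  inv := (((a⁻¹ : (InfiniteAdeleRing E)ˣ) : InfiniteAdeleRing E), RestrictedProduct.mk
    (fun w => if P w then ((x⁻¹ : ideleGroup E) : AdeleRing (𝓞 E) E).2 w else 1)
    (Filter.Eventually.of_forall fun w => by
      by_cases h : P w
      · simp only [h, ↓reduceIte]
        exact (HeightOneSpectrum.mem_adicCompletionIntegers _ _ _).mpr ((unitIdeles E).inv_mem hx w).le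
      · simp only [h, ↓reduceIte]; exact one_mem _))
  val_inv := by
    refine Prod.ext ?_ (FiniteAdeleRing.ext E fun w => ?_)
    · show (a : InfiniteAdeleRing E) * ((a⁻¹ : (InfiniteAdeleRing E)ˣ) : InfiniteAdeleRing E) = 1
      rw [← Units.val_mul, mul_inv_cancel, Units.val_one]
    show (if P w then (x : AdeleRing (𝓞 E) E).2 w else 1) *
      (if P w then ((x⁻¹ : ideleGroup E) : AdeleRing (𝓞 E) E).2 w else 1) = 1
    by_cases h : P w
    · rw [if_pos h, if_pos h, snd_inv_apply, mul_inv_cancel₀ (snd_apply_ne_zero x w)]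
    · rw [if_neg h, if_neg h, mul_one]
  inv_val := by
    refine Prod.ext ?_ (FiniteAdeleRing.ext E fun w => ?_)
    · show ((a⁻¹ : (InfiniteAdeleRing E)ˣ) : InfiniteAdeleRing E) * (a : InfiniteAdeleRing E) = 1
      rw [← Units.val_mul, inv_mul_cancel, Units.val_one]
    show (if P w then ((x⁻¹ : ideleGroup E) : AdeleRing (𝓞 E) E).2 w else 1) *
      (if P w then (x : AdeleRing (𝓞 E) E).2 w else 1) = 1
    by_cases h : P w
    · rw [if_pos h, if_pos h, snd_inv_apply, inv_mul_cancel₀ (snd_apply_ne_zero x w)]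
    · rw [if_neg h, if_neg h, mul_one]

/-- Infinite part of `piece`. [folklore] -/
@[simp] theorem piece_fst (a : (InfiniteAdeleRing E)ˣ) (x : ideleGroup E) (hx : x ∈ unitIdeles E)
    (P : HeightOneSpectrum (𝓞 E) → Prop) : ((piece a x hx P : ideleGroup E) : AdeleRing (𝓞 E) E).1 = a := rfl

/-- Finite components of `piece`. [folklore] -/
theorem piece_snd_apply (a : (InfiniteAdeleRing E)ˣ) (x : ideleGroup E) (hx : x ∈ unitIdeles E)
    (P : HeightOneSpectrum (𝓞 E) → Prop) (w : HeightOneSpectrum (𝓞 E)) :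
    ((piece a x hx P : ideleGroup E) : AdeleRing (𝓞 E) E).2 w =
      if P w then (x : AdeleRing (𝓞 E) E).2 w else 1 := rfl

end Piece

variable (F E) in
/-- **`𝓔_S`**: the unit ideles supported above the finite set `S` of finite places of `F` and at
infinity (Childress's `∏_{v ∈ S ∪ S_∞} ∏_{w ∣ v} 𝒰_w`). [cite: Childress2009, Ch. 4 §5 (PDF p. 92)] -/
def unitIdelesOn (S : Finset (HeightOneSpectrum (𝓞 F))) : Subgroup (ideleGroup E) where
  carrier := {x | x ∈ unitIdeles E ∧ ∀ w : HeightOneSpectrum (𝓞 E), w.under (𝓞 F) ∉ S →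
    (x : AdeleRing (𝓞 E) E).2 w = 1}
  one_mem' := ⟨Subgroup.one_mem _, fun w _ => rfl⟩
  mul_mem' := fun {x y} hx hy => ⟨Subgroup.mul_mem _ hx.1 hy.1, fun w hw => by
    rw [snd_mul_apply, hx.2 w hw, hy.2 w hw, mul_one]⟩
  inv_mem' := fun {x} hx => ⟨Subgroup.inv_mem _ hx.1, fun w hw => by
    rw [snd_inv_apply, hx.2 w hw, inv_one]⟩

variable (F E) in
/-- **`𝓔^S`**: the unit ideles trivial above `S` and at infinity (Childress's
`∏_{v ∉ S ∪ S_∞} ∏_{w ∣ v} 𝒰_w`). [cite: Childress2009, Ch. 4 §5 (PDF p. 92)] -/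
def unitIdelesOff (S : Finset (HeightOneSpectrum (𝓞 F))) : Subgroup (ideleGroup E) where
  carrier := {x | x ∈ unitIdeles E ∧ (x : AdeleRing (𝓞 E) E).1 = 1 ∧
    ∀ w : HeightOneSpectrum (𝓞 E), w.under (𝓞 F) ∈ S → (x : AdeleRing (𝓞 E) E).2 w = 1}
  one_mem' := ⟨Subgroup.one_mem _, rfl, fun w _ => rfl⟩
  mul_mem' := fun {x y} hx hy => ⟨Subgroup.mul_mem _ hx.1 hy.1,
    by rw [ideleGroup_val_fst_mul, hx.2.1, hy.2.1, mul_one], fun w hw => by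
    rw [snd_mul_apply, hx.2.2 w hw, hy.2.2 w hw, mul_one]⟩
  inv_mem' := fun {x} hx => ⟨Subgroup.inv_mem _ hx.1, fst_inv_eq_one hx.2.1, fun w hw => by
    rw [snd_inv_apply, hx.2.2 w hw, inv_one]⟩

variable {S : Finset (HeightOneSpectrum (𝓞 F))}

/-- `𝓔_S` is stable. [cite: CasselsFrohlichANT1967, Ch. VII §1.1] -/
theorem isStable_unitIdelesOn : Herbrand.IsStable (E ≃ₐ[F] E) (unitIdelesOn F E S) := by
  intro σ x hx
  refine ⟨isStable_unitIdeles σ hx.1, fun w hw => ?_⟩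
  rw [snd_smul_apply, hx.2 _ (by rwa [HeightOneSpectrum.under_algEquiv_smul]), map_one]

/-- `𝓔^S` is stable. [cite: CasselsFrohlichANT1967, Ch. VII §1.1] -/
theorem isStable_unitIdelesOff : Herbrand.IsStable (E ≃ₐ[F] E) (unitIdelesOff F E S) := by
  intro σ x hx
  refine ⟨isStable_unitIdeles σ hx.1, by rw [fst_smul, hx.2.1, smul_one], fun w hw => ?_⟩
  rw [snd_smul_apply, hx.2.2 _ (by rwa [HeightOneSpectrum.under_algEquiv_smul]), map_one]

omit [NumberField F] in
/-- **`𝓔_E = 𝓔_S · 𝓔^S`.** [cite: Childress2009, Ch. 4 §5 (PDF p. 92)] -/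
theorem unitIdelesOn_sup_unitIdelesOff : unitIdelesOn F E S ⊔ unitIdelesOff F E S = unitIdeles E := by
  classical
  refine le_antisymm (sup_le (fun x hx => hx.1) (fun x hx => hx.1)) (fun x hx => ?_)
  set a : ideleGroup E := piece (infHom E x) x hx (fun w => w.under (𝓞 F) ∈ S) with ha
  set b : ideleGroup E := piece 1 x hx (fun w => w.under (𝓞 F) ∉ S) with hb
  have hab : x = a * b := by
    apply Units.ext
    refine Prod.ext ?_ (FiniteAdeleRing.ext E fun w => ?_)
    · rw [ideleGroup_val_fst_mul, ha, hb, piece_fst, piece_fst, Units.val_one, mul_one]; rfl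
    · rw [snd_mul_apply, ha, hb, piece_snd_apply, piece_snd_apply]
      by_cases h : w.under (𝓞 F) ∈ S
      · rw [if_pos h, if_neg (not_not.mpr h), mul_one]
      · rw [if_neg h, if_pos h, one_mul]
  have haU : a ∈ unitIdelesOn F E S := by
    refine ⟨fun w => ?_, fun w hw => by rw [ha, piece_snd_apply, if_neg hw]⟩
    rw [ha, piece_snd_apply]
    split_ifs <;> first | exact hx w | exact map_one _
  have hbU : b ∈ unitIdelesOff F E S := by
    refine ⟨fun w => ?_, rfl, fun w hw => by rw [hb, piece_snd_apply, if_neg (not_not.mpr hw)]⟩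
    rw [hb, piece_snd_apply]
    split_ifs <;> first | exact hx w | exact map_one _
  rw [hab]
  exact Subgroup.mul_mem _ (Subgroup.mem_sup_left haU) (Subgroup.mem_sup_right hbU)

omit [NumberField F] in
/-- **`𝓔_S ∩ 𝓔^S = 1`.** [folklore] -/
theorem unitIdelesOn_inf_unitIdelesOff : unitIdelesOn F E S ⊓ unitIdelesOff F E S = ⊥ := by
  rw [eq_bot_iff]
  rintro x ⟨hxa, hxb⟩
  rw [Subgroup.mem_bot]
  apply Units.ext
  refine Prod.ext hxb.2.1 (FiniteAdeleRing.ext E fun w => ?_)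
  by_cases h : w.under (𝓞 F) ∈ S
  · exact hxb.2.2 w h
  · exact hxa.2 w h

omit [NumberField F] in
/-- Elements of `∏_{v ∈ t} localUnitIdeles v` have trivial infinite part. [folklore] -/
theorem fst_eq_one_of_mem_finsetSup {t : Finset (HeightOneSpectrum (𝓞 F))} {x : ideleGroup E}
    (hx : x ∈ t.sup (localUnitIdeles F E)) : (x : AdeleRing (𝓞 E) E).1 = 1 := by
  let K : Subgroup (ideleGroup E) :=
    { carrier := {x | (x : AdeleRing (𝓞 E) E).1 = 1}
      one_mem' := rfl
      mul_mem' := fun {a b} ha hb => by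
        show ((a * b : ideleGroup E) : AdeleRing (𝓞 E) E).1 = 1
        rw [ideleGroup_val_fst_mul, ha, hb, mul_one]
      inv_mem' := fun {a} ha => fst_inv_eq_one ha }
  have hle : t.sup (localUnitIdeles F E) ≤ K := Finset.sup_le fun v _ y hy => hy.1
  exact hle hx

omit [NumberField F] in
/-- Elements of `∏_{v ∈ t} localUnitIdeles v` are trivial at the finite places not above `t`.
[folklore] -/
theorem snd_eq_one_of_mem_finsetSup {t : Finset (HeightOneSpectrum (𝓞 F))} {x : ideleGroup E}
    (hx : x ∈ t.sup (localUnitIdeles F E)) (w : HeightOneSpectrum (𝓞 E)) (hw : w.under (𝓞 F) ∉ t) :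
    (x : AdeleRing (𝓞 E) E).2 w = 1 := by
  let K : Subgroup (ideleGroup E) :=
    { carrier := {x | (x : AdeleRing (𝓞 E) E).2 w = 1}
      one_mem' := rfl
      mul_mem' := fun {a b} ha hb => by
        show ((a * b : ideleGroup E) : AdeleRing (𝓞 E) E).2 w = 1
        rw [snd_mul_apply, ha, hb, mul_one]
      inv_mem' := fun {a} ha => by
        show ((a⁻¹ : ideleGroup E) : AdeleRing (𝓞 E) E).2 w = 1
        rw [snd_inv_apply, ha, inv_one] }
  have hle : t.sup (localUnitIdeles F E) ≤ K :=
    Finset.sup_le fun v hv y hy => hy.2.1 w (fun h => hw (h ▸ hv))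
  exact hle hx

omit [NumberField F] in
/-- Elements of `∏_{v ∈ t} localUnitIdeles v` are unit ideles. [folklore] -/
theorem mem_unitIdeles_of_mem_finsetSup {t : Finset (HeightOneSpectrum (𝓞 F))} {x : ideleGroup E}
    (hx : x ∈ t.sup (localUnitIdeles F E)) : x ∈ unitIdeles E := by
  have hle : t.sup (localUnitIdeles F E) ≤ unitIdeles E := Finset.sup_le fun v _ y hy => hy.2.2
  exact hle hx

omit [NumberField F] in
/-- The `localUnitIdeles v` are independent. [folklore] -/
theorem finsetSup_localUnitIdeles_inf_eq_bot (t : Finset (HeightOneSpectrum (𝓞 F)))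
    (v : HeightOneSpectrum (𝓞 F)) (hv : v ∉ t) :
    t.sup (localUnitIdeles F E) ⊓ localUnitIdeles F E v = ⊥ := by
  rw [eq_bot_iff]
  rintro x ⟨hxt, hxv⟩
  rw [Subgroup.mem_bot]
  apply Units.ext
  refine Prod.ext hxv.1 (FiniteAdeleRing.ext E fun w => ?_)
  by_cases hw : w.under (𝓞 F) = v
  · exact snd_eq_one_of_mem_finsetSup hxt w (by rwa [hw])
  · exact hxv.2.1 w hw

omit [NumberField F] in
/-- `infIdeles` meets `∏_{v ∈ S} localUnitIdeles v` trivially. [folklore] -/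
theorem infIdeles_inf_finsetSup_eq_bot (t : Finset (HeightOneSpectrum (𝓞 F))) :
    infIdeles E ⊓ t.sup (localUnitIdeles F E) = ⊥ := by
  rw [eq_bot_iff]
  rintro x ⟨hxi, hxt⟩
  rw [Subgroup.mem_bot]
  apply Units.ext
  exact Prod.ext (fst_eq_one_of_mem_finsetSup hxt) hxi

omit [NumberField F] in
/-- **`𝓔_S = E_∞ˣ · ∏_{v ∈ S} ∏_{w ∣ v} 𝒰_w`.** [cite: Childress2009, Ch. 4 §5 (PDF p. 92)] -/
theorem unitIdelesOn_eq_sup : unitIdelesOn F E S = infIdeles E ⊔ S.sup (localUnitIdeles F E) := by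
  classical
  refine le_antisymm (fun x hx => ?_) (sup_le (fun x hx => ?_) (fun x hx => ?_))
  · -- decompose `x = x_∞ · ∏_{v ∈ S} ofBlock (block_v x)`
    have hblk : ∀ v, blockHom F E v x ∈ SemiLocal.unitGroup F E v := fun v w => by
      rw [blockHom_apply]; exact hx.1 _
    have hdec : x = infiniteIdeles E (infHom E x) * ∏ v ∈ S, ofBlock (blockHom F E v x) (hblk v) := by
      apply Units.ext
      refine Prod.ext ?_ (FiniteAdeleRing.ext E fun w => ?_)
      · rw [ideleGroup_val_fst_mul, fst_prod, Finset.prod_eq_one (fun v _ => ofBlock_fst _ _), mul_one]; rfl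
      · rw [snd_mul_apply, snd_prod_apply]
        have h1 : ((infiniteIdeles E (infHom E x) : ideleGroup E) : AdeleRing (𝓞 E) E).2 w = 1 := rfl
        rw [h1, one_mul]
        by_cases hw : w.under (𝓞 F) ∈ S
        · rw [Finset.prod_eq_single (w.under (𝓞 F))]
          · rw [ofBlock_snd_apply_of_eq _ _ rfl]; rfl
          · intro v _ hv; exact ofBlock_snd_apply_of_ne _ _ (Ne.symm hv)
          · intro h; exact absurd hw h
        · rw [hx.2 w hw]
          exact (Finset.prod_eq_one fun v hv => ofBlock_snd_apply_of_ne _ _ (fun h => hw (h ▸ hv))).symm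
    rw [hdec]
    refine Subgroup.mul_mem _ (Subgroup.mem_sup_left (infiniteIdeles_mem _)) (Subgroup.mem_sup_right ?_)
    exact Subgroup.prod_mem _ fun v hv =>
      Finset.le_sup (f := localUnitIdeles F E) hv (ofBlock_mem _ _)
  · -- `infIdeles ≤ unitIdelesOn`
    have h2 : ∀ w, (x : AdeleRing (𝓞 E) E).2 w = 1 := fun w => by
      have := hx; rw [mem_infIdeles_iff] at this
      exact congrFun (congrArg DFunLike.coe this) w
    exact ⟨fun w => by rw [h2 w, map_one], fun w _ => h2 w⟩
  · exact ⟨mem_unitIdeles_of_mem_finsetSup hx, fun w hw => snd_eq_one_of_mem_finsetSup hx w hw⟩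

variable [IsGalois F E] [FiniteDimensional F E]

/-- **`#Ĥ⁰(G, 𝓔_S) = 2^a · ∏_{v ∈ S} #Ĥ⁰(∏_{w∣v} 𝒰_w)`** for `Gal(E/F) = ⟨σ⟩` cyclic.
[cite: Childress2009, Ch. 4 §5 Prop. 5.7 and proof of Thm. 5.11 (PDF pp. 98–99, 102)] -/
theorem h0_unitIdelesOn_eq {σ : E ≃ₐ[F] E} (hσ : ∀ τ : E ≃ₐ[F] E, τ ∈ Subgroup.zpowers σ) :
    Herbrand.h0 σ (unitIdelesOn F E S) ⊥ =
      ArchHerbrand.archFactor F E * ∏ v ∈ S, Herbrand.h0 σ (localUnitIdeles F E v) ⊥ := by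
  rw [unitIdelesOn_eq_sup, Herbrand.h0_sup_bot_eq_mul (isStable_infIdeles (F := F))
    (Herbrand.isStable_finsetSup _ _ fun v => isStable_localUnitIdeles (v := v))
    (infIdeles_inf_finsetSup_eq_bot S), h0_infIdeles_eq (F := F), ArchHerbrand.h0_top_eq_archFactor hσ,
    Herbrand.h0_finsetSup_eq_prod _ _ (fun v => isStable_localUnitIdeles (v := v))
    (fun t v hv => finsetSup_localUnitIdeles_inf_eq_bot t v hv)]

/-- **`#Ĥ⁻¹(G, 𝓔_S) = ∏_{v ∈ S} #Ĥ⁰(∏_{w∣v} 𝒰_w)`** for `Gal(E/F) = ⟨σ⟩` cyclic.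
[cite: Childress2009, Ch. 4 §5 Prop. 5.7 and proof of Thm. 5.11 (PDF pp. 98–99, 102)] -/
theorem h1_unitIdelesOn_eq {σ : E ≃ₐ[F] E} (hσ : ∀ τ : E ≃ₐ[F] E, τ ∈ Subgroup.zpowers σ) :
    Herbrand.h1 σ (unitIdelesOn F E S) ⊥ = ∏ v ∈ S, Herbrand.h0 σ (localUnitIdeles F E v) ⊥ := by
  rw [unitIdelesOn_eq_sup, Herbrand.h1_sup_bot_eq_mul (isStable_infIdeles (F := F))
    (Herbrand.isStable_finsetSup _ _ fun v => isStable_localUnitIdeles (v := v))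
    (infIdeles_inf_finsetSup_eq_bot S), h1_infIdeles_eq (F := F), ArchHerbrand.h1_top_eq_one hσ, one_mul,
    Herbrand.h1_finsetSup_eq_prod _ _ (fun v => isStable_localUnitIdeles (v := v))
    (fun t v hv => finsetSup_localUnitIdeles_inf_eq_bot t v hv)]
  exact Finset.prod_congr rfl fun v _ => ((h0_localUnitIdeles_eq_h1 hσ (v := v)).1).symm

/-- `∏_{v ∈ S} #Ĥ⁰(∏_{w∣v} 𝒰_w) ≠ 0`. [cite: Childress2009, Ch. 4 §5 Prop. 5.7 (i) (PDF p. 98)] -/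
theorem prod_h0_localUnitIdeles_ne_zero {σ : E ≃ₐ[F] E} (hσ : ∀ τ : E ≃ₐ[F] E, τ ∈ Subgroup.zpowers σ) :
    ∏ v ∈ S, Herbrand.h0 σ (localUnitIdeles F E v) ⊥ ≠ 0 :=
  Finset.prod_ne_zero_iff.mpr fun v _ => (h0_localUnitIdeles_eq_h1 hσ (v := v)).2

/-! ### `𝓔^S` has trivial `Ĥ⁰`, `Ĥ⁻¹` when the local units outside `S` do -/

section OfBlocks

open scoped Classical

omit [IsGalois F E] [FiniteDimensional F E]

/-- The unit idele assembled from blocks `y_v ∈ ∏_{w ∣ v} 𝒪_wˣ` at the finite places `v ∉ S`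
(`1` above `S` and at infinity). [folklore] -/
def ofBlocks (y : ∀ v : HeightOneSpectrum (𝓞 F), (SemiLocal F E v)ˣ)
    (hy : ∀ v, y v ∈ SemiLocal.unitGroup F E v) (S : Finset (HeightOneSpectrum (𝓞 F))) : ideleGroup E where
  val := (1, RestrictedProduct.mk
    (fun w => if w.under (𝓞 F) ∈ S then 1 else (y (w.under (𝓞 F)) : SemiLocal F E _) ⟨w, rfl⟩)
    (Filter.Eventually.of_forall fun w => by
      by_cases h : w.under (𝓞 F) ∈ S
      · simp only [h, ↓reduceIte]; exact one_mem _
      · simp only [h, ↓reduceIte]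
        exact (HeightOneSpectrum.mem_adicCompletionIntegers _ _ _).mpr (hy _ ⟨w, rfl⟩).le))
  inv := (1, RestrictedProduct.mk
    (fun w => if w.under (𝓞 F) ∈ S then 1 else ((y (w.under (𝓞 F)))⁻¹ : (SemiLocal F E _)ˣ).1 ⟨w, rfl⟩)
    (Filter.Eventually.of_forall fun w => by
      by_cases h : w.under (𝓞 F) ∈ S
      · simp only [h, ↓reduceIte]; exact one_mem _
      · simp only [h, ↓reduceIte]
        exact (HeightOneSpectrum.mem_adicCompletionIntegers _ _ _).mpr
          ((SemiLocal.unitGroup F E _).inv_mem (hy _) ⟨w, rfl⟩).le))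
  val_inv := by
    refine Prod.ext (mul_one _) (FiniteAdeleRing.ext E fun w => ?_)
    show (if w.under (𝓞 F) ∈ S then (1 : w.adicCompletion E) else (y (w.under (𝓞 F)) : SemiLocal F E _) ⟨w, rfl⟩) *
      (if w.under (𝓞 F) ∈ S then (1 : w.adicCompletion E) else
        ((y (w.under (𝓞 F)))⁻¹ : (SemiLocal F E _)ˣ).1 ⟨w, rfl⟩) = 1
    by_cases h : w.under (𝓞 F) ∈ S
    · rw [if_pos h, if_pos h, mul_one]
    · rw [if_neg h, if_neg h]
      exact congrFun (congrArg Units.val (mul_inv_cancel (y (w.under (𝓞 F))))) ⟨w, rfl⟩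
  inv_val := by
    refine Prod.ext (mul_one _) (FiniteAdeleRing.ext E fun w => ?_)
    show (if w.under (𝓞 F) ∈ S then (1 : w.adicCompletion E) else
        ((y (w.under (𝓞 F)))⁻¹ : (SemiLocal F E _)ˣ).1 ⟨w, rfl⟩) *
      (if w.under (𝓞 F) ∈ S then (1 : w.adicCompletion E) else (y (w.under (𝓞 F)) : SemiLocal F E _) ⟨w, rfl⟩) = 1
    by_cases h : w.under (𝓞 F) ∈ S
    · rw [if_pos h, if_pos h, mul_one]
    · rw [if_neg h, if_neg h]
      exact congrFun (congrArg Units.val (inv_mul_cancel (y (w.under (𝓞 F))))) ⟨w, rfl⟩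

variable (y : ∀ v : HeightOneSpectrum (𝓞 F), (SemiLocal F E v)ˣ) (hy : ∀ v, y v ∈ SemiLocal.unitGroup F E v)

omit [NumberField F] in
/-- Infinite part of `ofBlocks`. [folklore] -/
@[simp] theorem ofBlocks_fst : ((ofBlocks y hy S : ideleGroup E) : AdeleRing (𝓞 E) E).1 = 1 := rfl

omit [NumberField F] in
/-- Finite components of `ofBlocks` above `S`. [folklore] -/
theorem ofBlocks_snd_apply_of_mem {w : HeightOneSpectrum (𝓞 E)} (hw : w.under (𝓞 F) ∈ S) :
    ((ofBlocks y hy S : ideleGroup E) : AdeleRing (𝓞 E) E).2 w = 1 := by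
  show (if w.under (𝓞 F) ∈ S then (1 : w.adicCompletion E) else (y (w.under (𝓞 F)) : SemiLocal F E _) ⟨w, rfl⟩) = 1
  rw [if_pos hw]

omit [NumberField F] in
/-- Finite components of `ofBlocks` off `S`. [folklore] -/
theorem ofBlocks_snd_apply_of_not_mem {w : HeightOneSpectrum (𝓞 E)} (hw : w.under (𝓞 F) ∉ S) :
    ((ofBlocks y hy S : ideleGroup E) : AdeleRing (𝓞 E) E).2 w = (y (w.under (𝓞 F)) : SemiLocal F E _) ⟨w, rfl⟩ := by
  show (if w.under (𝓞 F) ∈ S then (1 : w.adicCompletion E) else (y (w.under (𝓞 F)) : SemiLocal F E _) ⟨w, rfl⟩) = _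
  rw [if_neg hw]

omit [NumberField F] in
/-- **The blocks of `ofBlocks` off `S` are the prescribed ones.** [folklore] -/
theorem blockHom_ofBlocks {v : HeightOneSpectrum (𝓞 F)} (hv : v ∉ S) :
    blockHom F E v (ofBlocks y hy S) = y v := by
  apply Units.ext; funext w'
  obtain ⟨w, hw⟩ := w'
  subst hw
  show ((ofBlocks y hy S : ideleGroup E) : AdeleRing (𝓞 E) E).2 w = _
  rw [ofBlocks_snd_apply_of_not_mem y hy hv]

omit [NumberField F] in
/-- `ofBlocks y S ∈ 𝓔^S`. [folklore] -/
theorem ofBlocks_mem : ofBlocks y hy S ∈ unitIdelesOff F E S := by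
  refine ⟨fun w => ?_, rfl, fun w hw => ofBlocks_snd_apply_of_mem y hy hw⟩
  by_cases hw : w.under (𝓞 F) ∈ S
  · rw [ofBlocks_snd_apply_of_mem y hy hw, map_one]
  · rw [ofBlocks_snd_apply_of_not_mem y hy hw]; exact hy (w.under (𝓞 F)) ⟨w, rfl⟩

end OfBlocks

omit [NumberField F] [IsGalois F E] [FiniteDimensional F E] in
/-- Two elements of `𝓔^S` with the same blocks off `S` are equal. [folklore] -/
theorem eq_of_blockHom_eq {x x' : ideleGroup E} (hx : x ∈ unitIdelesOff F E S) (hx' : x' ∈ unitIdelesOff F E S)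
    (h : ∀ v ∉ S, blockHom F E v x = blockHom F E v x') : x = x' := by
  apply Units.ext
  refine Prod.ext (by rw [hx.2.1, hx'.2.1]) (FiniteAdeleRing.ext E fun w => ?_)
  by_cases hw : w.under (𝓞 F) ∈ S
  · rw [hx.2.2 w hw, hx'.2.2 w hw]
  · have := congrArg (fun u : (SemiLocal F E (w.under (𝓞 F)))ˣ => (u : SemiLocal F E _) ⟨w, rfl⟩) (h _ hw)
    exact this

omit [IsGalois F E] [FiniteDimensional F E] in
/-- The norm of the Herbrand calculus commutes with the block projections. [folklore] -/
theorem blockHom_norm [Fintype (E ≃ₐ[F] E)] (v : HeightOneSpectrum (𝓞 F)) (x : ideleGroup E) :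
    blockHom F E v (Herbrand.norm (E ≃ₐ[F] E) x) = Herbrand.norm (E ≃ₐ[F] E) (blockHom F E v x) :=
  Herbrand.map_norm_eq (blockHom F E v) (fun g z => blockHom_smul g z) x

omit [IsGalois F E] [FiniteDimensional F E] in
/-- `σ y / y` commutes with the block projections. [folklore] -/
theorem blockHom_twist (σ : E ≃ₐ[F] E) (v : HeightOneSpectrum (𝓞 F)) (x : ideleGroup E) :
    blockHom F E v (Herbrand.twist σ x) = Herbrand.twist σ (blockHom F E v x) :=
  Herbrand.map_twist_eq (blockHom F E v) (fun g z => blockHom_smul g z) x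

omit [IsGalois F E] [FiniteDimensional F E] in
/-- `𝓔^S` is stable under the norm. [folklore] -/
theorem norm_mem_unitIdelesOff [Fintype (E ≃ₐ[F] E)] {x : ideleGroup E} (hx : x ∈ unitIdelesOff F E S) :
    Herbrand.norm (E ≃ₐ[F] E) x ∈ unitIdelesOff F E S :=
  isStable_unitIdelesOff.norm_mem hx

omit [IsGalois F E] [FiniteDimensional F E] in
/-- `𝓔^S` is stable under `σ - 1`. [folklore] -/
theorem twist_mem_unitIdelesOff (σ : E ≃ₐ[F] E) {x : ideleGroup E} (hx : x ∈ unitIdelesOff F E S) :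
    Herbrand.twist σ x ∈ unitIdelesOff F E S :=
  isStable_unitIdelesOff.twist_mem σ hx

omit [IsGalois F E] [FiniteDimensional F E] in
/-- **`#Ĥ⁰(G, 𝓔^S) = 1` when, for `v ∉ S`, every `G`-fixed element of `∏_{w∣v} 𝒪_wˣ` is a norm
from it** (Childress Prop. 5.7 (iii) via Lemma 5.3 for `S ⊇` ramified places; here a hypothesis):
the local preimages assemble into a unit idele. [cite: Childress2009, Ch. 4 §5 Prop. 5.7 (iii) (PDF p. 99)] -/
theorem h0_unitIdelesOff_eq_one [Fintype (E ≃ₐ[F] E)] {σ : E ≃ₐ[F] E}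
    (hσ : ∀ τ : E ≃ₐ[F] E, τ ∈ Subgroup.zpowers σ)
    (hun : ∀ v ∉ S, ∀ z ∈ SemiLocal.unitGroup F E v, (∀ g : E ≃ₐ[F] E, g • z = z) →
      ∃ y ∈ SemiLocal.unitGroup F E v, Herbrand.norm (E ≃ₐ[F] E) y = z) :
    Herbrand.h0 σ (unitIdelesOff F E S) ⊥ = 1 := by
  classical
  rw [Herbrand.h0_eq_one_iff]
  intro x hx hfix
  rw [Subgroup.mem_bot, div_eq_one] at hfix
  have hfix' : ∀ g : E ≃ₐ[F] E, g • x = x := (Herbrand.forall_smul_eq_iff hσ).mpr hfix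
  have hblk : ∀ v, blockHom F E v x ∈ SemiLocal.unitGroup F E v := fun v w => by
    rw [blockHom_apply]; exact hx.1 _
  have hloc : ∀ v, ∃ y ∈ SemiLocal.unitGroup F E v,
      v ∉ S → Herbrand.norm (E ≃ₐ[F] E) y = blockHom F E v x := by
    intro v
    by_cases hv : v ∈ S
    · exact ⟨1, Subgroup.one_mem _, fun h => absurd hv h⟩
    · obtain ⟨y, hy, hyx⟩ := hun v hv _ (hblk v) fun g => by rw [← blockHom_smul, hfix' g]
      exact ⟨y, hy, fun _ => hyx⟩
  choose y hy hyN using hloc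
  rw [Herbrand.b0_bot]
  refine ⟨ofBlocks y hy S, ofBlocks_mem y hy, ?_⟩
  refine eq_of_blockHom_eq (norm_mem_unitIdelesOff (ofBlocks_mem y hy)) hx fun v hv => ?_
  rw [blockHom_norm, blockHom_ofBlocks y hy hv, hyN v hv]

omit [IsGalois F E] [FiniteDimensional F E] in
/-- **`#Ĥ⁻¹(G, 𝓔^S) = 1` when, for `v ∉ S`, every norm-one element of `∏_{w∣v} 𝒪_wˣ` is
`σy/y` from it.** [cite: Childress2009, Ch. 4 §5 Prop. 5.7 (iii) (PDF p. 99)] -/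
theorem h1_unitIdelesOff_eq_one [Fintype (E ≃ₐ[F] E)] {σ : E ≃ₐ[F] E}
    (hun : ∀ v ∉ S, ∀ z ∈ SemiLocal.unitGroup F E v, Herbrand.norm (E ≃ₐ[F] E) z = 1 →
      ∃ y ∈ SemiLocal.unitGroup F E v, Herbrand.twist σ y = z) :
    Herbrand.h1 σ (unitIdelesOff F E S) ⊥ = 1 := by
  classical
  rw [Herbrand.h1_eq_one_iff]
  intro x hx hN
  rw [Subgroup.mem_bot] at hN
  have hblk : ∀ v, blockHom F E v x ∈ SemiLocal.unitGroup F E v := fun v w => by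
    rw [blockHom_apply]; exact hx.1 _
  have hloc : ∀ v, ∃ y ∈ SemiLocal.unitGroup F E v,
      v ∉ S → Herbrand.twist σ y = blockHom F E v x := by
    intro v
    by_cases hv : v ∈ S
    · exact ⟨1, Subgroup.one_mem _, fun h => absurd hv h⟩
    · obtain ⟨y, hy, hyx⟩ := hun v hv _ (hblk v) (by rw [← blockHom_norm, hN, map_one])
      exact ⟨y, hy, fun _ => hyx⟩
  choose y hy hyT using hloc
  rw [Herbrand.b1_bot]
  refine ⟨ofBlocks y hy S, ofBlocks_mem y hy, ?_⟩
  refine eq_of_blockHom_eq (twist_mem_unitIdelesOff σ (ofBlocks_mem y hy)) hx fun v hv => ?_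
  rw [blockHom_twist, blockHom_ofBlocks y hy hv, hyT v hv]

/-! ### Assembly: `Q_G(𝓔_E) = 2^a` -/

/-- **`#Ĥ⁰(G, 𝓔_E) = 2^a · ∏_{v ∈ S} #Ĥ⁰(∏_{w∣v} 𝒰_w)`** for `Gal(E/F) = ⟨σ⟩` cyclic and `S` a
finite set of finite places of `F` outside which the local units have trivial `Ĥ⁰`.
[cite: Childress2009, Ch. 4 §5 Prop. 5.7, "Q_G(𝓔_K) = 2^a" (PDF pp. 98–99)] -/
theorem h0_unitIdeles_eq {σ : E ≃ₐ[F] E} (hσ : ∀ τ : E ≃ₐ[F] E, τ ∈ Subgroup.zpowers σ)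
    (hun : ∀ v ∉ S, ∀ z ∈ SemiLocal.unitGroup F E v, (∀ g : E ≃ₐ[F] E, g • z = z) →
      ∃ y ∈ SemiLocal.unitGroup F E v, Herbrand.norm (E ≃ₐ[F] E) y = z) :
    Herbrand.h0 σ (unitIdeles E) ⊥ =
      ArchHerbrand.archFactor F E * ∏ v ∈ S, Herbrand.h0 σ (localUnitIdeles F E v) ⊥ := by
  rw [← unitIdelesOn_sup_unitIdelesOff (S := S), Herbrand.h0_sup_bot_eq_mul isStable_unitIdelesOn
    isStable_unitIdelesOff unitIdelesOn_inf_unitIdelesOff, h0_unitIdelesOn_eq hσ,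
    h0_unitIdelesOff_eq_one hσ hun, mul_one]

/-- **`#Ĥ⁻¹(G, 𝓔_E) = ∏_{v ∈ S} #Ĥ⁰(∏_{w∣v} 𝒰_w)`** for `Gal(E/F) = ⟨σ⟩` cyclic and `S` a finite
set of finite places of `F` outside which the local units have trivial `Ĥ⁻¹`; with
`h0_unitIdeles_eq`: `Q_G(𝓔_E) = 2^a`.
[cite: Childress2009, Ch. 4 §5 Prop. 5.7, "Q_G(𝓔_K) = 2^a" (PDF pp. 98–99)] -/
theorem h1_unitIdeles_eq {σ : E ≃ₐ[F] E} (hσ : ∀ τ : E ≃ₐ[F] E, τ ∈ Subgroup.zpowers σ)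
    (hun : ∀ v ∉ S, ∀ z ∈ SemiLocal.unitGroup F E v, Herbrand.norm (E ≃ₐ[F] E) z = 1 →
      ∃ y ∈ SemiLocal.unitGroup F E v, Herbrand.twist σ y = z) :
    Herbrand.h1 σ (unitIdeles E) ⊥ = ∏ v ∈ S, Herbrand.h0 σ (localUnitIdeles F E v) ⊥ := by
  rw [← unitIdelesOn_sup_unitIdelesOff (S := S), Herbrand.h1_sup_bot_eq_mul isStable_unitIdelesOn
    isStable_unitIdelesOff unitIdelesOn_inf_unitIdelesOff, h1_unitIdelesOn_eq hσ,
    h1_unitIdelesOff_eq_one hun, mul_one]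

end IdeleHerbrand

end Literature.NumberTheory.GaloisRepresentations
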